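import Literature.NumberTheory.Weil1964.UnitaryArchLocalCayleyWeightDet          -- ★ p844641 (this seat) (b3)-(i): `cayleyWeightC_eq` (`w₀(Y) = ‖det(1+Y)‖^{−2N}`)
import Literature.NumberTheory.Weil1964.UnitaryArchLocalCayleyWeightMassOne      -- ★ p844681 (this seat) (b3)-(iii) `N = 1`: `lintegral_cayleyWeightC_one`
import Literature.NumberTheory.Weil1964.UnitaryArchLocalCayleySingularNull       -- ★ A-p06 (g29) (b3)-(ii): `setLIntegral_cayleySourceC_eq` (the Cayley-singular locus is null)
import Literature.NumberTheory.Weil1964.UnitaryArchLocalTraceFormNondegenerate   -- ★ `lieGramDetC_ne_zero_of_conjTranspose_eq`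
import Literature.Analysis.SpecialFunctions.InvAddSqPowIntegrals                 -- ★ p844750 (this seat) FILE C: `∫ ((w+x²)²)⁻¹`, `∫ ((w+x²)³)⁻¹`, completed square
import Mathlib.MeasureTheory.Constructions.HaarToSphere                           -- `integral_fun_norm_addHaar`, `integrable_fun_norm_addHaar` (polar coordinates)
import Mathlib.MeasureTheory.Measure.Lebesgue.VolumeOfBalls                       -- `Complex.volume_ball`
import Mathlib.MeasureTheory.Measure.Haar.InnerProductSpace                       -- `OrthonormalBasis.addHaar_eq_volume`
import Mathlib.Analysis.SpecialFunctions.ImproperIntegrals                        -- `integral_Ioi_of_hasDerivAt_of_nonneg`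
import HarnessLib

/-!
# (U) ROAD, U4-DISCHARGE brick (b3)-(iii), `N = 2`: the Cayley-weighted trace-form Lebesgue mass of `𝔲(2)` is `π³∕2` — `∫_{𝔲(1₂)} w₀ dλ = π³∕2`
# (Rogawski 1990 §1.7 p. 6 «`dg = |Ω|_v`»; Macdonald 1980)

Topic `NumberTheory/Weil1964`; namespace `Literature.NumberTheory.Weil1964.UnitaryArchLocalTopForm`.  THEOREMS ONLY (no definition, no instance, no notation,
no named fact, no `sorry`); kernel lane.  Cell `pub/hodgecm-mathlib` (D-0151), crux H413 = `stmt-HodgeConjecture-24833` (supports only); ROAD (U), U4-DISCHARGE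
package (LEAD F0P3a-plan (g10) WORD T9-40 (d1): (b3) «`m_w = μ^TF_w(U(2)×U(1))`» = A-p12 (g20); owner A-p19 (g24), junction ★ p844714
`archTopFormWallCompatible_of_blockMasses_of_clause` + `UnitaryArchLocalTopFormMassUniversal.lean` (`V₂ := (∫⁻_{source(1₂)} w₀ dλ).toNNReal`,
`V₁ := (∫⁻_{source(1₁)} w₀ dλ).toNNReal`); split of record: (i) Jacobian ★ p844641, (ii) null complement ★ `UnitaryArchLocalCayleySingularNull` (A-p06 (g29)),
(iii) THE VALUES (this seat): `N = 1` ★ p844681 (`= π`), `N = 2` THIS FILE (`= π³∕2`)).  HONEST LABEL: HC_CM is proved only modulo the cell's 2 remaining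
named inputs (hLiu418 24832, h413 24833) until rung 0 closes; this file pays no letter by itself — it IDENTIFIES the owner's block masses
`V₂ = π³∕2`, `V₁ = π` (so the (J-nc) constant of (b2) is `−V₂·V₁ = −π⁴∕2`).

THE MATHEMATICS.  `𝔲(2) = 𝔲(1₂) = {X | Xᴴ + X = 0} = {!![ia, z; -z̄, ib] | a b : ℝ, z : ℂ}` (`mem_skewC_two_one`, `eq_of_mem_skewC_two_one`); the coordinate
map `ψ : (ℝ × ℝ) × ℂ ≃L[ℝ] 𝔲(2)` (built inside the proof) carries the orthonormal coordinate basis to `E₁ = diag(i,0)`, `E₂ = diag(0,i)`, `E₃ = !![0,1;-1,0]`,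
`E₄ = !![0,i;i,0]`, whose trace-form Gram matrix `Re tr(E_i E_j)` is `diag(−1,−1,−2,−2)` (determinant `4`), so ★ `lieStdLebesgueC_eq_smul_addHaar` reads
**`λ = 2 · ψ_*(da db dz)`** (Mathlib `Module.Basis.prod_addHaar`, `OrthonormalBasis.addHaar_eq_volume`, `Module.Basis.map_addHaar`).  By ★ `cayleyWeightC_eq`,
`w₀(Y) = |det(1+Y)|⁻⁴` and `det(1 + !![ia, z; -z̄, ib]) = (1+ia)(1+ib) + |z|² = (1 − ab + |z|²) + (a+b)i` (`det_one_add_coord`), so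
**`w₀ = (((1 − ab + |z|²)² + (a+b)²)²)⁻¹`** (`cayleyWeightC_two_one_coord`).  Tonelli in the order `a, b, z` makes every step a one-dimensional closed form:
(1) completing the square, `(1 − ab + s)² + (a+b)² = (1+b²)(a − bs∕(1+b²))² + (1+s+b²)²∕(1+b²)` (`s = |z|²`), ★ `integral_univ_inv_quadratic_sq` gives
`∫ da = π(1+b²)∕(2(1+s+b²)³)` (`integral_coord_weight`); (2) `(1+b²)∕(w+b²)³ = (w+b²)⁻² + (1−w)(w+b²)⁻³` (`w = 1+s`) and ★ `integral_univ_inv_add_sq_sq`∕`_cube` give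
`∫ db = π²√(1+s)(4+s)∕(16(1+s)³)` (`integral_coord_weight₂`); (3) polar coordinates on `ℂ` (Mathlib `integral_fun_norm_addHaar`, `vol(B(0,1)) = π`) and the primitive
`−((1+r²)√(1+r²))⁻¹ − (√(1+r²))⁻¹` of `r√(1+r²)(4+r²)∕(1+r²)³` (`hasDerivAt_radial`, `integral_radial` `= 2`) give `∫_ℂ dz = π³∕4` (`integral_coord_weight₃`);
times the Gram factor `2`: **`∫⁻ w₀ dλ = π³∕2`** (`lintegral_cayleyWeightC_two`, stated with `hJw : Jw = 1` so that the owner's reference carrier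
`Matrix.diagonal (fun _ => ((1:ℝ):ℂ))` instantiates by `simp`).  With ★ `setLIntegral_cayleySourceC_eq` (the singular locus is `λ`-null) the SOURCE forms the junction
consumes follow: `setLIntegral_cayleyWeightC_cayleySourceC_two` (`= π³∕2`) and `setLIntegral_cayleyWeightC_cayleySourceC_one` (`= π`).
Numerical cross-check (earlier in this base): `∫_{ℝ⁴} 2 d⁴x ∕ ((1−ab+|z|²)² + (a+b)²)² = 0.5001·π³` on a `1200²`-point `tan`-substituted midpoint rule.
Classically: `vol(U(2)) = vol(SU(2))·vol(U(1))∕|μ₂| = (2π²)(2π)∕2 = 2π³` for the metric `−½ Re tr`, i.e. `π³∕2` after the factor `2^{−dim∕2} = ¼` of the trace form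
`−Re tr` (Macdonald 1980, p. 93, `U(n)`: `vol = ∏_{k=1}^{n} 2π^k∕(k−1)!` in his normalisation).

## References
* [Rogawski1990] J. D. Rogawski, *Automorphic Representations of Unitary Groups in Three Variables* (1990), §1.7 p. 6 (`dg = |Ω|_v`).
* [Macdonald1980] I. G. Macdonald, *The volume of a compact Lie group*, Invent. Math. 56 (1980), 93–95.
* [Knapp2002] A. W. Knapp, *Lie Groups Beyond an Introduction*, 2nd ed. (2002), I §1 (`𝔲(n)`), VIII §2.
* [GradshteynRyzhik2015] I. S. Gradshteyn, I. M. Ryzhik, *Table of Integrals, Series, and Products*, 8th ed. (2015), 2.148.4, 2.271, 3.249.1.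
-/

set_option autoImplicit false
set_option backward.isDefEq.respectTransparency false

noncomputable section

open Set MeasureTheory MeasureTheory.Measure Module Matrix Real Filter Topology
open scoped Classical Matrix Matrix.Norms.Operator MatrixGroups ENNReal NNReal Pointwise ComplexConjugate

namespace Literature.NumberTheory.Weil1964

namespace UnitaryArchLocalTopForm

open Literature.Analysis.SpecialFunctions Complex

/-! ## `𝔲(2) = {X | Xᴴ + X = 0}` in coordinates `(a, b, z) ↦ !![ia, z; -z̄, ib]` -/

/-- Entry relations in `𝔲(1_N) = {X | Xᴴ + X = 0}`: `conj (X j i) + X i j = 0`. [cite: Knapp2002, I §1] -/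
theorem conj_apply_add_apply_eq_zero_of_mem_skewC_one {N : ℕ} {X : Matrix (Fin N) (Fin N) ℂ}
    (hX : X ∈ skewC N (1 : Matrix (Fin N) (Fin N) ℂ)) (i j : Fin N) : conj (X j i) + X i j = 0 := by
  rw [mem_skewC_iff, Matrix.mul_one, Matrix.one_mul] at hX
  have h := congrFun (congrFun hX i) j
  simpa [Matrix.add_apply, Matrix.conjTranspose_apply] using h

/-- Diagonal entries of an element of `𝔲(1_N)` are purely imaginary. [cite: Knapp2002, I §1] -/
theorem apply_eq_im_mul_I_of_mem_skewC_one {N : ℕ} {X : Matrix (Fin N) (Fin N) ℂ}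
    (hX : X ∈ skewC N (1 : Matrix (Fin N) (Fin N) ℂ)) (i : Fin N) : X i i = ((X i i).im : ℂ) * I := by
  have h := congrArg Complex.re (conj_apply_add_apply_eq_zero_of_mem_skewC_one hX i i)
  simp only [Complex.add_re, Complex.conj_re, Complex.zero_re] at h
  apply Complex.ext
  · simp only [Complex.mul_re, Complex.ofReal_re, Complex.I_re, mul_zero, Complex.ofReal_im,
      Complex.I_im, zero_mul, sub_zero]
    linarith
  · simp only [Complex.mul_im, Complex.ofReal_re, Complex.I_im, mul_one, Complex.ofReal_im,
      Complex.I_re, mul_zero, add_zero]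

/-- Off-diagonal entries of an element of `𝔲(1_N)`: `X i j = -conj (X j i)`. [cite: Knapp2002, I §1] -/
theorem apply_eq_neg_conj_apply_of_mem_skewC_one {N : ℕ} {X : Matrix (Fin N) (Fin N) ℂ}
    (hX : X ∈ skewC N (1 : Matrix (Fin N) (Fin N) ℂ)) (i j : Fin N) : X i j = -conj (X j i) :=
  eq_neg_of_add_eq_zero_right (conj_apply_add_apply_eq_zero_of_mem_skewC_one hX i j)

/-- The coordinate matrices `!![ia, z; -z̄, ib]` (`a b : ℝ`, `z : ℂ`) lie in `𝔲(2)`. [cite: Knapp2002, I §1] -/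
theorem mem_skewC_two_one (a b : ℝ) (z : ℂ) :
    !![(a : ℂ) * I, z; -conj z, (b : ℂ) * I] ∈ skewC 2 (1 : Matrix (Fin 2) (Fin 2) ℂ) := by
  rw [mem_skewC_iff, Matrix.mul_one, Matrix.one_mul]
  ext i j
  fin_cases i <;> fin_cases j <;> simp [Matrix.add_apply, Complex.conj_ofReal]

/-- Every element of `𝔲(2)` is a coordinate matrix `!![ia, z; -z̄, ib]` with `a = Im X₀₀`, `b = Im X₁₁`, `z = X₀₁`. [cite: Knapp2002, I §1] -/
theorem eq_of_mem_skewC_two_one {X : Matrix (Fin 2) (Fin 2) ℂ} (hX : X ∈ skewC 2 (1 : Matrix (Fin 2) (Fin 2) ℂ)) :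
    X = !![((X 0 0).im : ℂ) * I, X 0 1; -conj (X 0 1), ((X 1 1).im : ℂ) * I] := by
  ext i j
  fin_cases i <;> fin_cases j
  · simpa using apply_eq_im_mul_I_of_mem_skewC_one hX 0
  · simp
  · simpa using apply_eq_neg_conj_apply_of_mem_skewC_one hX 1 0
  · simpa using apply_eq_im_mul_I_of_mem_skewC_one hX 1

/-- `det(1 + !![ia, z; -z̄, ib]) = (1 - ab + |z|²) + (a + b) i`. [cite: Knapp2002, I §1] -/
theorem det_one_add_coord (a b : ℝ) (z : ℂ) :
    (1 + !![(a : ℂ) * I, z; -conj z, (b : ℂ) * I]).det = ((1 - a * b + ‖z‖ ^ 2 : ℝ) : ℂ) + ((a + b : ℝ) : ℂ) * I := by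
  rw [Matrix.det_fin_two]
  have hz : z * conj z = ((‖z‖ ^ 2 : ℝ) : ℂ) := by
    rw [Complex.mul_conj, Complex.normSq_eq_norm_sq]
  simp only [Matrix.add_apply, Matrix.one_apply_eq, Matrix.one_apply_ne (show (0 : Fin 2) ≠ 1 by decide),
    Matrix.one_apply_ne (show (1 : Fin 2) ≠ 0 by decide), Matrix.of_apply, Matrix.cons_val',
    Matrix.cons_val_zero, Matrix.cons_val_one, Matrix.empty_val', Matrix.cons_val_fin_one, zero_add]
  rw [show z * -conj z = -((‖z‖ ^ 2 : ℝ) : ℂ) by rw [mul_neg, hz]]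
  push_cast
  ring_nf
  rw [Complex.I_sq]
  ring

/-- **The Cayley weight of `𝔲(2)` in coordinates**: `w₀(!![ia, z; -z̄, ib]) = (((1 - ab + |z|²)² + (a+b)²)²)⁻¹` (★ `cayleyWeightC_eq`: `w₀ = |det(1+Y)|⁻⁴`).
[cite: Rogawski1990, §1.7 p. 6] [cite: Knapp2002, I §1] -/
theorem cayleyWeightC_two_one_coord (a b : ℝ) (z : ℂ) :
    cayleyWeightC 2 (1 : Matrix (Fin 2) (Fin 2) ℂ) ⟨!![(a : ℂ) * I, z; -conj z, (b : ℂ) * I], mem_skewC_two_one a b z⟩ =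
      (((1 - a * b + ‖z‖ ^ 2) ^ 2 + (a + b) ^ 2) ^ 2)⁻¹ := by
  rw [cayleyWeightC_eq (Matrix.conjTranspose_one) (by simp)]
  dsimp only
  rw [det_one_add_coord, pow_mul, Complex.sq_norm, Complex.normSq_add_mul_I]

/-! ## The three one-dimensional integrations -/

/-- Completing the square in `a`: `(1 - ab + s)² + (a+b)² = (1+b²)(a - bs/(1+b²))² + (1+s+b²)²/(1+b²)`. [cite: GradshteynRyzhik2015, 2.148.4] -/
theorem coord_quadratic_eq (a b s : ℝ) :
    (1 - a * b + s) ^ 2 + (a + b) ^ 2 =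
      (1 + b ^ 2) * (a - b * s / (1 + b ^ 2)) ^ 2 + (1 + s + b ^ 2) ^ 2 / (1 + b ^ 2) := by
  have hb : 1 + b ^ 2 ≠ 0 := by positivity
  field_simp
  ring

/-- Step 1 (integrability in `a`). [cite: GradshteynRyzhik2015, 3.249.1] -/
theorem integrable_coord_weight (b s : ℝ) (hs : 0 ≤ s) :
    Integrable fun a : ℝ => ((((1 - a * b + s) ^ 2 + (a + b) ^ 2)) ^ 2)⁻¹ := by
  simp_rw [coord_quadratic_eq]
  exact integrable_inv_quadratic_sq (by positivity) (by positivity) _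

/-- **Step 1**: `∫_ℝ da / ((1 - ab + s)² + (a+b)²)² = π (1+b²) / (2 (1+s+b²)³)` (`s ≥ 0`). [cite: GradshteynRyzhik2015, 3.249.1] -/
theorem integral_coord_weight (b s : ℝ) (hs : 0 ≤ s) :
    ∫ a : ℝ, ((((1 - a * b + s) ^ 2 + (a + b) ^ 2)) ^ 2)⁻¹ = π * (1 + b ^ 2) / (2 * (1 + s + b ^ 2) ^ 3) := by
  simp_rw [coord_quadratic_eq]
  have hA : (0 : ℝ) < 1 + b ^ 2 := by positivity
  have hw : (0 : ℝ) < 1 + s + b ^ 2 := by positivity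
  rw [integral_univ_inv_quadratic_sq hA (by positivity) _]
  have hsq : (1 + s + b ^ 2) ^ 2 / (1 + b ^ 2) / (1 + b ^ 2) = ((1 + s + b ^ 2) / (1 + b ^ 2)) ^ 2 := by
    field_simp
  rw [hsq, Real.sqrt_sq (by positivity)]
  field_simp

/-- Step 2 (integrability in `b`). [cite: GradshteynRyzhik2015, 3.249.1] -/
theorem integrable_coord_weight₂ (s : ℝ) (hs : 0 ≤ s) :
    Integrable fun b : ℝ => π * (1 + b ^ 2) / (2 * (1 + s + b ^ 2) ^ 3) := by
  have hw : (0 : ℝ) < 1 + s := by positivity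
  have key : ∀ b : ℝ, π * (1 + b ^ 2) / (2 * (1 + s + b ^ 2) ^ 3) =
      π / 2 * ((((1 + s) + b ^ 2) ^ 2)⁻¹ + (1 - (1 + s)) * (((1 + s) + b ^ 2) ^ 3)⁻¹) := by
    intro b
    have hb : (0 : ℝ) < 1 + s + b ^ 2 := by positivity
    field_simp
    ring
  simp_rw [key]
  exact ((integrable_inv_add_sq_pow hw one_le_two).add
    ((integrable_inv_add_sq_pow hw (by norm_num : 1 ≤ 3)).const_mul _)).const_mul _

/-- **Step 2**: `∫_ℝ π (1+b²) db / (2 (1+s+b²)³) = π² √(1+s) (4+s) / (16 (1+s)³)` (`s ≥ 0`). [cite: GradshteynRyzhik2015, 3.249.1] -/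
theorem integral_coord_weight₂ (s : ℝ) (hs : 0 ≤ s) :
    ∫ b : ℝ, π * (1 + b ^ 2) / (2 * (1 + s + b ^ 2) ^ 3) = π ^ 2 * (√(1 + s) * (4 + s)) / (16 * (1 + s) ^ 3) := by
  have hw : (0 : ℝ) < 1 + s := by positivity
  have key : ∀ b : ℝ, π * (1 + b ^ 2) / (2 * (1 + s + b ^ 2) ^ 3) =
      π / 2 * ((((1 + s) + b ^ 2) ^ 2)⁻¹ + (1 - (1 + s)) * (((1 + s) + b ^ 2) ^ 3)⁻¹) := by
    intro b
    have hb : (0 : ℝ) < 1 + s + b ^ 2 := by positivity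
    field_simp
    ring
  simp_rw [key]
  rw [integral_const_mul, integral_add (integrable_inv_add_sq_pow hw one_le_two)
    ((integrable_inv_add_sq_pow hw (by norm_num : 1 ≤ 3)).const_mul _), integral_const_mul,
    integral_univ_inv_add_sq_sq hw, integral_univ_inv_add_sq_cube hw]
  field_simp
  ring

/-- The radial antiderivative: `d/dr [-( (1+r²)√(1+r²) )⁻¹ - (√(1+r²))⁻¹] = r √(1+r²) (4+r²) / (1+r²)³`. [cite: GradshteynRyzhik2015, 2.271] -/
theorem hasDerivAt_radial (r : ℝ) :
    HasDerivAt (fun r : ℝ => -(((1 + r ^ 2) * √(1 + r ^ 2))⁻¹) - (√(1 + r ^ 2))⁻¹)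
      (r * (√(1 + r ^ 2) * (4 + r ^ 2)) / (1 + r ^ 2) ^ 3) r := by
  have h0 : (0 : ℝ) < 1 + r ^ 2 := by positivity
  have hs : 0 < √(1 + r ^ 2) := Real.sqrt_pos.mpr h0
  have h1 : HasDerivAt (fun r : ℝ => 1 + r ^ 2) (2 * r) r := by
    simpa using (hasDerivAt_pow 2 r).const_add 1
  have h2 : HasDerivAt (fun r : ℝ => √(1 + r ^ 2)) (2 * r / (2 * √(1 + r ^ 2))) r := h1.sqrt h0.ne'
  have h3 : HasDerivAt (fun r : ℝ => (1 + r ^ 2) * √(1 + r ^ 2))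
      (2 * r * √(1 + r ^ 2) + (1 + r ^ 2) * (2 * r / (2 * √(1 + r ^ 2)))) r := h1.mul h2
  have h4 := (h3.fun_inv (by positivity)).neg.sub (h2.fun_inv hs.ne')
  refine h4.congr_deriv ?_
  have hsq : √(1 + r ^ 2) ^ 2 = 1 + r ^ 2 := Real.sq_sqrt h0.le
  set u := √(1 + r ^ 2) with hu
  have hu0 : u ≠ 0 := hs.ne'
  rw [show (4 : ℝ) + r ^ 2 = 3 + u ^ 2 by rw [hsq]; ring, ← hsq]
  field_simp
  ring

/-- The radial integrand is nonnegative. [cite: GradshteynRyzhik2015, 2.271] -/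
theorem radial_nonneg {r : ℝ} (hr : 0 ≤ r) : 0 ≤ r * (√(1 + r ^ 2) * (4 + r ^ 2)) / (1 + r ^ 2) ^ 3 := by
  positivity

/-- The radial primitive tends to `0` at `+∞`. [cite: GradshteynRyzhik2015, 2.271] -/
theorem tendsto_radial_atTop :
    Tendsto (fun r : ℝ => -(((1 + r ^ 2) * √(1 + r ^ 2))⁻¹) - (√(1 + r ^ 2))⁻¹) atTop (𝓝 0) := by
  have h1 : Tendsto (fun r : ℝ => 1 + r ^ 2) atTop atTop :=
    tendsto_atTop_add_const_left _ _ (tendsto_pow_atTop two_ne_zero)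
  have h2 : Tendsto (fun r : ℝ => √(1 + r ^ 2)) atTop atTop := Real.tendsto_sqrt_atTop.comp h1
  have h3 : Tendsto (fun r : ℝ => (1 + r ^ 2) * √(1 + r ^ 2)) atTop atTop := h1.atTop_mul_atTop₀ h2
  have := ((tendsto_inv_atTop_zero.comp h3).neg).sub (tendsto_inv_atTop_zero.comp h2)
  simpa using this

/-- **Step 3 (radial)**: `∫_0^∞ r √(1+r²) (4+r²) dr / (1+r²)³ = 2`. [cite: GradshteynRyzhik2015, 2.271] -/
theorem integral_radial :
    ∫ r in Ioi (0 : ℝ), r * (√(1 + r ^ 2) * (4 + r ^ 2)) / (1 + r ^ 2) ^ 3 = 2 := by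
  rw [integral_Ioi_of_hasDerivAt_of_nonneg (a := 0)
    ((hasDerivAt_radial 0).continuousAt.continuousWithinAt)
    (fun r _ => hasDerivAt_radial r) (fun _ hr => radial_nonneg (le_of_lt hr)) tendsto_radial_atTop]
  norm_num

/-- Step 3 (radial integrability). [cite: GradshteynRyzhik2015, 2.271] -/
theorem integrableOn_radial :
    IntegrableOn (fun r : ℝ => r * (√(1 + r ^ 2) * (4 + r ^ 2)) / (1 + r ^ 2) ^ 3) (Ioi 0) :=
  integrableOn_Ioi_deriv_of_nonneg (a := 0) ((hasDerivAt_radial 0).continuousAt.continuousWithinAt)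
    (fun r _ => hasDerivAt_radial r) (fun _ hr => radial_nonneg (le_of_lt hr)) tendsto_radial_atTop

/-- **Step 3**: `∫_ℂ π² √(1+|z|²) (4+|z|²) dz / (16 (1+|z|²)³) = π³/4` (polar coordinates: `∫_ℂ f(|z|) = 2π ∫_0^∞ r f(r) dr`). [cite: GradshteynRyzhik2015, 3.249.1] -/
theorem integral_coord_weight₃ :
    ∫ z : ℂ, π ^ 2 * (√(1 + ‖z‖ ^ 2) * (4 + ‖z‖ ^ 2)) / (16 * (1 + ‖z‖ ^ 2) ^ 3) = π ^ 3 / 4 := by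
  have h := integral_fun_norm_addHaar (volume : Measure ℂ)
    (fun r : ℝ => π ^ 2 * (√(1 + r ^ 2) * (4 + r ^ 2)) / (16 * (1 + r ^ 2) ^ 3))
  rw [h, Complex.finrank_real_complex, measureReal_def, Complex.volume_ball]
  have key : ∀ y : ℝ, y ^ (2 - 1) • (π ^ 2 * (√(1 + y ^ 2) * (4 + y ^ 2)) / (16 * (1 + y ^ 2) ^ 3)) =
      π ^ 2 / 16 * (y * (√(1 + y ^ 2) * (4 + y ^ 2)) / (1 + y ^ 2) ^ 3) := by
    intro y
    rw [show 2 - 1 = 1 from rfl, pow_one, smul_eq_mul]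
    field_simp
  simp_rw [key]
  rw [integral_const_mul, integral_radial]
  simp
  ring

/-- Step 3 (integrability on `ℂ`). [cite: GradshteynRyzhik2015, 3.249.1] -/
theorem integrable_coord_weight₃ :
    Integrable fun z : ℂ => π ^ 2 * (√(1 + ‖z‖ ^ 2) * (4 + ‖z‖ ^ 2)) / (16 * (1 + ‖z‖ ^ 2) ^ 3) := by
  have h := (integrable_fun_norm_addHaar (volume : Measure ℂ)
    (f := fun r : ℝ => π ^ 2 * (√(1 + r ^ 2) * (4 + r ^ 2)) / (16 * (1 + r ^ 2) ^ 3))).mpr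
  apply h
  rw [Complex.finrank_real_complex]
  have key : ∀ y : ℝ, y ^ (2 - 1) • (π ^ 2 * (√(1 + y ^ 2) * (4 + y ^ 2)) / (16 * (1 + y ^ 2) ^ 3)) =
      π ^ 2 / 16 * (y * (√(1 + y ^ 2) * (4 + y ^ 2)) / (1 + y ^ 2) ^ 3) := by
    intro y
    rw [show 2 - 1 = 1 from rfl, pow_one, smul_eq_mul]
    field_simp
  simp_rw [key]
  exact integrableOn_radial.const_mul _

/-! ## The mass -/

section Two

variable {Jw : Matrix (Fin 2) (Fin 2) ℂ}

variable [MeasurableSpace (skewC 2 Jw)] [BorelSpace (skewC 2 Jw)]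

/-- **(b3)-(iii), `N = 2`: `∫_{𝔲(2)} w₀ dλ = π³/2`** — the Cayley-weighted trace-form Lebesgue mass of `𝔲(2) = 𝔲(1₂)`: in the coordinates
`(a, b, z) ↦ !![ia, z; -z̄, ib]` the trace-form Lebesgue measure is `2 · da db dz` (Gram `diag(−1,−1,−2,−2)`) and `w₀ = (((1 − ab + |z|²)² + (a+b)²)²)⁻¹`
(★ `cayleyWeightC_eq`); Tonelli `a → b → z` with `integral_coord_weight`, `integral_coord_weight₂`, `integral_coord_weight₃` gives `2 · π³/4`.
Stated with `hJw : Jw = 1` (use `by simp` at the carrier `diagonal (fun _ => ((1:ℝ):ℂ))`).  This is `vol^TF(U(2)) = π³/2`, the `V₂` of the U4 junction.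
[cite: Rogawski1990, §1.7 p. 6] [cite: Macdonald1980, p. 93] -/
theorem lintegral_cayleyWeightC_two (hJw : Jw = 1) :
    ∫⁻ X, ENNReal.ofReal (cayleyWeightC 2 Jw X) ∂(lieStdLebesgueC 2 Jw) = ENNReal.ofReal (π ^ 3 / 2) := by
  subst hJw
  haveI : FiniteDimensional ℝ (Matrix (Fin 2) (Fin 2) ℂ) := finiteDimensional_matrixC
  -- the coordinate `ψ : (ℝ × ℝ) × ℂ ≃L[ℝ] 𝔲(2)`
  let ψₗ : ((ℝ × ℝ) × ℂ) ≃ₗ[ℝ] skewC 2 (1 : Matrix (Fin 2) (Fin 2) ℂ) :=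
    { toFun := fun p => ⟨!![(p.1.1 : ℂ) * I, p.2; -conj p.2, (p.1.2 : ℂ) * I], mem_skewC_two_one p.1.1 p.1.2 p.2⟩
      map_add' := fun p q => by
        apply Subtype.ext
        ext i j
        fin_cases i <;> fin_cases j <;> simp <;> ring
      map_smul' := fun t p => by
        apply Subtype.ext
        ext i j
        fin_cases i <;> fin_cases j <;> simp [Complex.real_smul, Complex.conj_ofReal] <;> ring
      invFun := fun X => ((((X : Matrix (Fin 2) (Fin 2) ℂ) 0 0).im, ((X : Matrix (Fin 2) (Fin 2) ℂ) 1 1).im),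
        (X : Matrix (Fin 2) (Fin 2) ℂ) 0 1)
      left_inv := fun p => by
        ext <;> simp
      right_inv := fun X => by
        apply Subtype.ext
        exact (eq_of_mem_skewC_two_one X.2).symm }
  let ψ : ((ℝ × ℝ) × ℂ) ≃L[ℝ] skewC 2 (1 : Matrix (Fin 2) (Fin 2) ℂ) := ψₗ.toContinuousLinearEquiv
  have hψ : ∀ p : (ℝ × ℝ) × ℂ, (ψ p : Matrix (Fin 2) (Fin 2) ℂ) = !![(p.1.1 : ℂ) * I, p.2; -conj p.2, (p.1.2 : ℂ) * I] :=
    fun _ => rfl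
  -- the coordinate basis and its Gram determinant
  set s₁ : Module.Basis (Fin 1) ℝ ℝ := (OrthonormalBasis.singleton (Fin 1) ℝ).toBasis with hs₁
  set cI : Module.Basis (Fin 2) ℝ ℂ := Complex.orthonormalBasisOneI.toBasis with hcI
  set bV : Module.Basis ((Fin 1 ⊕ Fin 1) ⊕ Fin 2) ℝ ((ℝ × ℝ) × ℂ) := (s₁.prod s₁).prod cI with hbV
  have hs₁v : s₁.addHaar = volume := (OrthonormalBasis.singleton (Fin 1) ℝ).addHaar_eq_volume
  have hcIv : cI.addHaar = volume := Complex.orthonormalBasisOneI.addHaar_eq_volume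
  have hbVv : bV.addHaar = volume := by
    rw [hbV, Module.Basis.prod_addHaar, Module.Basis.prod_addHaar, hs₁v, hcIv, ← Measure.volume_eq_prod,
      ← Measure.volume_eq_prod]
  have hs₁a : ∀ i, s₁ i = 1 := fun i => by
    rw [hs₁, OrthonormalBasis.coe_toBasis, OrthonormalBasis.singleton_apply]
  have hcI0 : cI 0 = 1 := by rw [hcI, Complex.toBasis_orthonormalBasisOneI, Complex.coe_basisOneI]; rfl
  have hcI1 : cI 1 = I := by rw [hcI, Complex.toBasis_orthonormalBasisOneI, Complex.coe_basisOneI]; rfl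
  set B : Module.Basis ((Fin 1 ⊕ Fin 1) ⊕ Fin 2) ℝ (skewC 2 (1 : Matrix (Fin 2) (Fin 2) ℂ)) := bV.map ψₗ with hB
  have hB1 : ∀ i, (B (Sum.inl (Sum.inl i)) : Matrix (Fin 2) (Fin 2) ℂ) = !![I, 0; 0, 0] := by
    intro i
    rw [hB, Module.Basis.map_apply]
    show (ψ (bV (Sum.inl (Sum.inl i))) : Matrix (Fin 2) (Fin 2) ℂ) = _
    rw [hψ, hbV, Module.Basis.prod_apply, Sum.elim_inl, Function.comp_apply, Module.Basis.prod_apply, Sum.elim_inl,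
      Function.comp_apply, hs₁a]
    simp
  have hB2 : ∀ i, (B (Sum.inl (Sum.inr i)) : Matrix (Fin 2) (Fin 2) ℂ) = !![0, 0; 0, I] := by
    intro i
    rw [hB, Module.Basis.map_apply]
    show (ψ (bV (Sum.inl (Sum.inr i))) : Matrix (Fin 2) (Fin 2) ℂ) = _
    rw [hψ, hbV, Module.Basis.prod_apply, Sum.elim_inl, Function.comp_apply, Module.Basis.prod_apply, Sum.elim_inr,
      Function.comp_apply, hs₁a]
    simp
  have hB3 : (B (Sum.inr 0) : Matrix (Fin 2) (Fin 2) ℂ) = !![0, 1; -1, 0] := by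
    rw [hB, Module.Basis.map_apply]
    show (ψ (bV (Sum.inr 0)) : Matrix (Fin 2) (Fin 2) ℂ) = _
    rw [hψ, hbV, Module.Basis.prod_apply, Sum.elim_inr, Function.comp_apply, hcI0]
    simp
  have hB4 : (B (Sum.inr 1) : Matrix (Fin 2) (Fin 2) ℂ) = !![0, I; I, 0] := by
    rw [hB, Module.Basis.map_apply]
    show (ψ (bV (Sum.inr 1)) : Matrix (Fin 2) (Fin 2) ℂ) = _
    rw [hψ, hbV, Module.Basis.prod_apply, Sum.elim_inr, Function.comp_apply, hcI1]
    simp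
  -- Gram matrix `diag(-1,-1,-2,-2)`, stated for every `DecidableEq` instance (★ `lieStdLebesgueC_eq_smul_addHaar` carries the classical one)
  have hgram : ∀ inst : DecidableEq ((Fin 1 ⊕ Fin 1) ⊕ Fin 2),
      @Matrix.det _ inst _ ℝ _ (lieGramC B) = 4 := by
    intro inst
    have hdiag : lieGramC B = Matrix.diagonal (Sum.elim (Sum.elim (fun _ : Fin 1 => (-1 : ℝ)) (fun _ : Fin 1 => -1)) ![-2, -2]) := by
      ext i j
      rw [lieGramC_apply, traceFormC_apply]
      rcases i with ((i | i) | i) <;> rcases j with ((j | j) | j)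
      all_goals fin_cases i <;> fin_cases j
      all_goals norm_num [hB1, hB2, hB3, hB4, Matrix.trace_fin_two, Matrix.diagonal, Sum.inl_ne_inr, Sum.inr_ne_inl]
    rw [hdiag, Matrix.det_diagonal]
    norm_num
  have hlam : lieStdLebesgueC 2 (1 : Matrix (Fin 2) (Fin 2) ℂ) = ENNReal.ofReal 2 • B.addHaar := by
    rw [lieStdLebesgueC_eq_smul_addHaar B, hgram]
    norm_num
  have hmap : B.addHaar = (volume : Measure ((ℝ × ℝ) × ℂ)).map ψ := by
    rw [← hbVv, Module.Basis.map_addHaar _ ψ, hB]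
    rfl
  -- the weight in coordinates
  have hw : ∀ p : (ℝ × ℝ) × ℂ, cayleyWeightC 2 (1 : Matrix (Fin 2) (Fin 2) ℂ) (ψ p) =
      (((1 - p.1.1 * p.1.2 + ‖p.2‖ ^ 2) ^ 2 + (p.1.1 + p.1.2) ^ 2) ^ 2)⁻¹ :=
    fun p => cayleyWeightC_two_one_coord p.1.1 p.1.2 p.2
  -- Tonelli
  rw [hlam, hmap, lintegral_smul_measure, lintegral_map (measurable_cayleyWeightC.ennreal_ofReal) ψ.continuous.measurable]
  simp_rw [hw]
  have hmeas : Measurable fun p : (ℝ × ℝ) × ℂ =>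
      ENNReal.ofReal ((((1 - p.1.1 * p.1.2 + ‖p.2‖ ^ 2) ^ 2 + (p.1.1 + p.1.2) ^ 2) ^ 2)⁻¹) := by
    fun_prop
  rw [Measure.volume_eq_prod, lintegral_prod_symm _ hmeas.aemeasurable]
  have h1 : ∀ z : ℂ, ∫⁻ ab : ℝ × ℝ, ENNReal.ofReal ((((1 - ab.1 * ab.2 + ‖z‖ ^ 2) ^ 2 + (ab.1 + ab.2) ^ 2) ^ 2)⁻¹) =
      ENNReal.ofReal (π ^ 2 * (√(1 + ‖z‖ ^ 2) * (4 + ‖z‖ ^ 2)) / (16 * (1 + ‖z‖ ^ 2) ^ 3)) := by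
    intro z
    have hs : (0 : ℝ) ≤ ‖z‖ ^ 2 := by positivity
    have hmeas2 : Measurable fun ab : ℝ × ℝ =>
        ENNReal.ofReal ((((1 - ab.1 * ab.2 + ‖z‖ ^ 2) ^ 2 + (ab.1 + ab.2) ^ 2) ^ 2)⁻¹) := by
      fun_prop
    rw [Measure.volume_eq_prod, lintegral_prod_symm _ hmeas2.aemeasurable]
    have h2 : ∀ b : ℝ, ∫⁻ a : ℝ, ENNReal.ofReal ((((1 - a * b + ‖z‖ ^ 2) ^ 2 + (a + b) ^ 2) ^ 2)⁻¹) =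
        ENNReal.ofReal (π * (1 + b ^ 2) / (2 * (1 + ‖z‖ ^ 2 + b ^ 2) ^ 3)) := by
      intro b
      rw [← integral_coord_weight b _ hs, ofReal_integral_eq_lintegral_ofReal (integrable_coord_weight b _ hs)
        (Filter.Eventually.of_forall fun a => by positivity)]
    simp only []
    simp_rw [h2]
    rw [← integral_coord_weight₂ _ hs, ofReal_integral_eq_lintegral_ofReal (integrable_coord_weight₂ _ hs)
      (Filter.Eventually.of_forall fun b => by positivity)]
  simp only []
  simp_rw [h1]
  rw [← ofReal_integral_eq_lintegral_ofReal integrable_coord_weight₃ (Filter.Eventually.of_forall fun z => by positivity),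
    integral_coord_weight₃, smul_eq_mul, ← ENNReal.ofReal_mul (by norm_num)]
  congr 1
  ring

/-- **(b3)-(iii), `N = 2`, SOURCE form** (the junction's `V₂`): `∫_{source(1₂)} w₀ dλ = π³/2` — the Cayley-singular locus is `λ`-null (★ `setLIntegral_cayleySourceC_eq`).
[cite: Rogawski1990, §1.7 p. 6] [cite: Macdonald1980, p. 93] -/
theorem setLIntegral_cayleyWeightC_cayleySourceC_two (hJw : Jw = 1) :
    ∫⁻ X in cayleySourceC 2 Jw, ENNReal.ofReal (cayleyWeightC 2 Jw X) ∂(lieStdLebesgueC 2 Jw) = ENNReal.ofReal (π ^ 3 / 2) := by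
  haveI := isAddHaarMeasure_lieStdLebesgueC
    (lieGramDetC_ne_zero_of_conjTranspose_eq (N := 2) (Jw := Jw) (by rw [hJw, Matrix.conjTranspose_one]) (by rw [hJw]; simp))
  rw [setLIntegral_cayleySourceC_eq, lintegral_cayleyWeightC_two hJw]

end Two

section One

variable {Jw : Matrix (Fin 1) (Fin 1) ℂ}

variable [MeasurableSpace (skewC 1 Jw)] [BorelSpace (skewC 1 Jw)]

/-- **(b3)-(iii), `N = 1`, SOURCE form** (the junction's `V₁`): `∫_{source} w₀ dλ = π` for every `1 × 1` hermitian invertible form (★ `lintegral_cayleyWeightC_one` +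
★ `setLIntegral_cayleySourceC_eq`). [cite: Rogawski1990, §1.7 p. 6] [cite: Macdonald1980, p. 93] -/
theorem setLIntegral_cayleyWeightC_cayleySourceC_one (hherm : Jwᴴ = Jw) (hJ : IsUnit Jw.det) :
    ∫⁻ X in cayleySourceC 1 Jw, ENNReal.ofReal (cayleyWeightC 1 Jw X) ∂(lieStdLebesgueC 1 Jw) = ENNReal.ofReal π := by
  haveI := isAddHaarMeasure_lieStdLebesgueC (lieGramDetC_ne_zero_of_conjTranspose_eq (N := 1) (Jw := Jw) hherm hJ)
  rw [setLIntegral_cayleySourceC_eq, lintegral_cayleyWeightC_one hherm hJ]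

end One

section DiagonalOne

variable [MeasurableSpace (skewC 2 (Matrix.diagonal fun _ : Fin 2 => ((1 : ℝ) : ℂ)))] [BorelSpace (skewC 2 (Matrix.diagonal fun _ : Fin 2 => ((1 : ℝ) : ℂ)))]

/-- **(b3)-(iii), `N = 2`, at the reference carrier `diagonal (fun _ => ((1:ℝ):ℂ))`** of ★ `UnitaryArchLocalTopFormMassUniversal` (SOURCE form, `= π³/2`).
[cite: Rogawski1990, §1.7 p. 6] [cite: Macdonald1980, p. 93] -/
theorem setLIntegral_cayleyWeightC_cayleySourceC_two_diagonal_one :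
    ∫⁻ X in cayleySourceC 2 (Matrix.diagonal fun _ : Fin 2 => ((1 : ℝ) : ℂ)),
        ENNReal.ofReal (cayleyWeightC 2 (Matrix.diagonal fun _ : Fin 2 => ((1 : ℝ) : ℂ)) X)
        ∂(lieStdLebesgueC 2 (Matrix.diagonal fun _ : Fin 2 => ((1 : ℝ) : ℂ))) = ENNReal.ofReal (π ^ 3 / 2) :=
  setLIntegral_cayleyWeightC_cayleySourceC_two (by simp)

end DiagonalOne

section PureIntegral

/-- **The pure `ℝ⁴`-integral behind `vol^TF(U(2))`** (ED. 2, by-name head for (n2) F0P3-p03 (g12)): `∫_{ℝ×ℝ×ℂ} da db dz ∕ ((1 − ab + |z|²)² + (a+b)²)² = π³∕4`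
(Tonelli `a → b → z`: `integral_coord_weight`, `integral_coord_weight₂`, `integral_coord_weight₃`; the trace-form mass is `2×` this).
[cite: GradshteynRyzhik2015, 3.249.1] [cite: Macdonald1980, p. 93] -/
theorem lintegral_coord_weight_volume :
    ∫⁻ p : (ℝ × ℝ) × ℂ, ENNReal.ofReal ((((1 - p.1.1 * p.1.2 + ‖p.2‖ ^ 2) ^ 2 + (p.1.1 + p.1.2) ^ 2) ^ 2)⁻¹) =
      ENNReal.ofReal (π ^ 3 / 4) := by
  have hmeas : Measurable fun p : (ℝ × ℝ) × ℂ =>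
      ENNReal.ofReal ((((1 - p.1.1 * p.1.2 + ‖p.2‖ ^ 2) ^ 2 + (p.1.1 + p.1.2) ^ 2) ^ 2)⁻¹) := by
    fun_prop
  rw [Measure.volume_eq_prod, lintegral_prod_symm _ hmeas.aemeasurable]
  have h1 : ∀ z : ℂ, ∫⁻ ab : ℝ × ℝ, ENNReal.ofReal ((((1 - ab.1 * ab.2 + ‖z‖ ^ 2) ^ 2 + (ab.1 + ab.2) ^ 2) ^ 2)⁻¹) =
      ENNReal.ofReal (π ^ 2 * (√(1 + ‖z‖ ^ 2) * (4 + ‖z‖ ^ 2)) / (16 * (1 + ‖z‖ ^ 2) ^ 3)) := by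
    intro z
    have hs : (0 : ℝ) ≤ ‖z‖ ^ 2 := by positivity
    have hmeas2 : Measurable fun ab : ℝ × ℝ =>
        ENNReal.ofReal ((((1 - ab.1 * ab.2 + ‖z‖ ^ 2) ^ 2 + (ab.1 + ab.2) ^ 2) ^ 2)⁻¹) := by
      fun_prop
    rw [Measure.volume_eq_prod, lintegral_prod_symm _ hmeas2.aemeasurable]
    have h2 : ∀ b : ℝ, ∫⁻ a : ℝ, ENNReal.ofReal ((((1 - a * b + ‖z‖ ^ 2) ^ 2 + (a + b) ^ 2) ^ 2)⁻¹) =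
        ENNReal.ofReal (π * (1 + b ^ 2) / (2 * (1 + ‖z‖ ^ 2 + b ^ 2) ^ 3)) := by
      intro b
      rw [← integral_coord_weight b _ hs, ofReal_integral_eq_lintegral_ofReal (integrable_coord_weight b _ hs)
        (Filter.Eventually.of_forall fun a => by positivity)]
    simp only []
    simp_rw [h2]
    rw [← integral_coord_weight₂ _ hs, ofReal_integral_eq_lintegral_ofReal (integrable_coord_weight₂ _ hs)
      (Filter.Eventually.of_forall fun b => by positivity)]
  simp only []
  simp_rw [h1]
  rw [← ofReal_integral_eq_lintegral_ofReal integrable_coord_weight₃ (Filter.Eventually.of_forall fun z => by positivity),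
    integral_coord_weight₃]

/-- **The reflected form** (`b ↦ −b`, a volume-preserving reflection of `ℝ × ℝ × ℂ`): `∫ da db dz ∕ ((1 + ab + |z|²)² + (a−b)²)² = π³∕4` — the `𝔲(1,1)`
integrand `|ĉ(Y)₀₀|⁻⁴ · w₀(Y)` of the (n2) disc-constant computation (F0P3-p03 (g12)). [cite: GradshteynRyzhik2015, 3.249.1] [cite: Macdonald1980, p. 93] -/
theorem lintegral_coord_weight_volume_reflect :
    ∫⁻ p : (ℝ × ℝ) × ℂ, ENNReal.ofReal ((((1 + p.1.1 * p.1.2 + ‖p.2‖ ^ 2) ^ 2 + (p.1.1 - p.1.2) ^ 2) ^ 2)⁻¹) =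
      ENNReal.ofReal (π ^ 3 / 4) := by
  have hg : MeasurePreserving (Prod.map (Prod.map (id : ℝ → ℝ) (Neg.neg : ℝ → ℝ)) (id : ℂ → ℂ))
      (volume : Measure ((ℝ × ℝ) × ℂ)) (volume : Measure ((ℝ × ℝ) × ℂ)) :=
    ((MeasurePreserving.id (volume : Measure ℝ)).prod (Measure.measurePreserving_neg (volume : Measure ℝ))).prod
      (MeasurePreserving.id (volume : Measure ℂ))
  have hf : Measurable fun p : (ℝ × ℝ) × ℂ =>
      ENNReal.ofReal ((((1 - p.1.1 * p.1.2 + ‖p.2‖ ^ 2) ^ 2 + (p.1.1 + p.1.2) ^ 2) ^ 2)⁻¹) := by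
    fun_prop
  rw [← lintegral_coord_weight_volume, ← hg.lintegral_comp hf]
  refine lintegral_congr ?_
  rintro ⟨⟨a, b⟩, z⟩
  simp only [Prod.map_apply, id_eq, mul_neg, sub_neg_eq_add, ← sub_eq_add_neg]

end PureIntegral

end UnitaryArchLocalTopForm

end Literature.NumberTheory.Weil1964

end
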